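import Literature.Analysis.FluidPDE.PassiveScalarGradientTransport
import Literature.Analysis.FluidPDE.NSHopfLimit
import Literature.Analysis.FluidPDE.SawtoothCascade
import HarnessLib

/-!
# K3′ `K3NonlinearClosure` (aside, stmt-AnomalousDissipation-20027), line `Localised` — STUB S2b
# `stub_shearGradientEnvelope`: the sup-gradient envelope across one pulse of the sawtooth cascade

Registered stub `stub_shearGradientEnvelope` of the line `Localised` (reshape r2: the second conjunct of the former
conjunction stub `stub_toolkit`, the predicate `ShearGradientEnvelope` spelled out).  For a classical solution `w` of
`∂ₜw + ū·∇w = κΔw` (`κ ≥ 0`) on a convex time set containing the phase `[tStart j, tStart (j+1)]` of the cascade field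
`ū = P.field` (`γ ≥ 0`, `δ₀ > 0`, `d ≥ 1`):

* across the H half-slot `[tStart j, tStart j + tHalf j]` the field is the single horizontal shear
  `(rateH j t · U j (x₂), 0)` (`SawtoothCascade` Part 9), so `∂₁ū = 0` and `|⟪∂₂ū, ∇w⟫| ≤ rateH · |∂₁w|`
  (`|U_j′| ≤ 1`, Part 10: `CascadeParams.partialDeriv_field_of_mem_H`, `abs_inner_partialDeriv_field_le_of_mem_H`);
  by the maximum principle for the differentiated equation (`PassiveScalarGradientTransport`:
  `abs_partialDeriv_le_of_partialDeriv_velocity_eq_zero`, `abs_partialDeriv_le_add_mul_integral_of_shear`)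
  `sup|∂₁w|` does not increase and `sup|∂₂w|` grows by at most `(∫ rateH) · sup|∂₁w(start)| ≤ γ · sup|∂₁w(start)|`
  (`integral_rateH_le`);
* symmetrically across the V half-slot `[tStart j + tHalf j, tStart (j+1)]` (`∂₂ū = 0`, `|⟪∂₁ū, ∇w⟫| ≤ rateV · |∂₂w|`).

The sups are real `iSup`s over the (compact) torus of the continuous `|∂ᵢ w(t, ·)|` (`Torus.IsSmooth.partialDeriv`),
coordinates of the gradient by `Torus.gradient_apply_eq_partialDeriv`.  No new definitions, no named facts.
-/

-- `Summit.<Summit>.<Problem>`: single-conjunct summit, the duplicate namespace segment is deliberate.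
set_option linter.dupNamespace false

noncomputable section

namespace Summit.AnomalousDissipation.AnomalousDissipation.Theorems.SawtoothPulseCascade.K3NonlinearClosureLocalised

open MeasureTheory Set Filter
open scoped InnerProductSpace
open Literature.Analysis Literature.Analysis.FunctionSpaces Literature.Analysis.FluidPDE
open Literature.Analysis.FluidPDE.SawtoothCascade
open CascadeParams

/-- For a smooth `θ : 𝕋² → ℝ`: the `i`-th gradient coordinate is the `i`-th partial derivative, `|∂ᵢθ|` is bounded,
and `|∂ᵢθ(x)| ≤ ⨆ y, |∇θ(y)ᵢ|`. -/
theorem abs_partialDeriv_le_iSup {θ : UnitAddTorus (Fin 2) → ℝ} (hθ : FunctionSpaces.Torus.IsSmooth θ)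
    (i : Fin 2) (x : UnitAddTorus (Fin 2)) :
    |FunctionSpaces.Torus.partialDeriv i θ x| ≤ ⨆ y, |FunctionSpaces.Torus.gradient θ y i| := by
  have hfun : (fun y => |FunctionSpaces.Torus.gradient θ y i|) = fun y => |FunctionSpaces.Torus.partialDeriv i θ y| :=
    funext fun y => by rw [Torus.gradient_apply_eq_partialDeriv (hθ.isContDiff (by simp)) y i]
  have hc : Continuous fun y => |FunctionSpaces.Torus.partialDeriv i θ y| := (hθ.partialDeriv i).continuous.abs
  have hbdd : BddAbove (range fun y => |FunctionSpaces.Torus.gradient θ y i|) := by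
    rw [hfun]; exact (isCompact_range hc).bddAbove
  have h := le_ciSup hbdd x
  rwa [Torus.gradient_apply_eq_partialDeriv (hθ.isContDiff (by simp)) x i] at h

/-- For a smooth `θ : 𝕋² → ℝ`, a pointwise bound of `|∂ᵢθ|` bounds `⨆ y, |∇θ(y)ᵢ|`. -/
theorem iSup_abs_gradient_le {θ : UnitAddTorus (Fin 2) → ℝ} (hθ : FunctionSpaces.Torus.IsSmooth θ)
    (i : Fin 2) {M : ℝ} (hM : ∀ x, |FunctionSpaces.Torus.partialDeriv i θ x| ≤ M) :
    (⨆ y, |FunctionSpaces.Torus.gradient θ y i|) ≤ M :=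
  ciSup_le fun y => by
    rw [Torus.gradient_apply_eq_partialDeriv (hθ.isContDiff (by simp)) y i]; exact hM y

/-- `0 ≤ ⨆ y, |∇θ(y)ᵢ|` for smooth `θ`. -/
theorem iSup_abs_gradient_nonneg {θ : UnitAddTorus (Fin 2) → ℝ} (hθ : FunctionSpaces.Torus.IsSmooth θ)
    (i : Fin 2) : 0 ≤ ⨆ y, |FunctionSpaces.Torus.gradient θ y i| :=
  (abs_nonneg _).trans (abs_partialDeriv_le_iSup hθ i 0)

/-- **STUB S2b `stub_shearGradientEnvelope`** of line `Localised` of the aside `K3NonlinearClosure`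
(stmt-AnomalousDissipation-20027): the sup-gradient envelope of a classical passive scalar across the H and the V
half-slot of phase `j` of the sawtooth cascade — `x₁`-gradient sup conserved and `x₂`-gradient sup amplified by at
most `γ ×` the `x₁`-gradient sup over the H half-pulse, and vice versa over the V half-pulse (maximum principle for the
differentiated equation with the shear source, total strain `∫ rate = γ`, slopes `|U_j′| ≤ 1`).
[cite: Evans2010, §7.1.4 Thms. 8–9 (maximum principle with source) with §7.1.3 Thm. 5]
[cite: ElgindiLissMattingly2025, §1 and Rmk. 1.4 (one shear at a time, ∫φ = α)] -/
theorem stub_shearGradientEnvelope :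
    ∀ (P : CascadeParams) (κ : ℝ) (j : ℕ) (S : Set ℝ) (w : ℝ → UnitAddTorus (Fin 2) → ℝ),
      0 ≤ κ → 0 ≤ P.γ → 0 < P.δ₀ → 1 ≤ P.d → Convex ℝ S →
      Icc (CascadeParams.tStart j) (CascadeParams.tStart (j + 1)) ⊆ S →
      FluidPDE.Torus.IsClassicalScalarTransportOn S κ P.field w →
      ((⨆ x, |FunctionSpaces.Torus.gradient (w (CascadeParams.tStart j + CascadeParams.tHalf j)) x 0|) ≤
          ⨆ x, |FunctionSpaces.Torus.gradient (w (CascadeParams.tStart j)) x 0|) ∧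
      ((⨆ x, |FunctionSpaces.Torus.gradient (w (CascadeParams.tStart j + CascadeParams.tHalf j)) x 1|) ≤
          (⨆ x, |FunctionSpaces.Torus.gradient (w (CascadeParams.tStart j)) x 1|) +
            P.γ * ⨆ x, |FunctionSpaces.Torus.gradient (w (CascadeParams.tStart j)) x 0|) ∧
      ((⨆ x, |FunctionSpaces.Torus.gradient (w (CascadeParams.tStart (j + 1))) x 1|) ≤
          ⨆ x, |FunctionSpaces.Torus.gradient (w (CascadeParams.tStart j + CascadeParams.tHalf j)) x 1|) ∧
      ((⨆ x, |FunctionSpaces.Torus.gradient (w (CascadeParams.tStart (j + 1))) x 0|) ≤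
          (⨆ x, |FunctionSpaces.Torus.gradient (w (CascadeParams.tStart j + CascadeParams.tHalf j)) x 0|) +
            P.γ * ⨆ x, |FunctionSpaces.Torus.gradient (w (CascadeParams.tStart j + CascadeParams.tHalf j)) x 1|) := by
  intro P κ j S w hκ hγ hδ₀ hd _ hI hw
  -- the phase clock
  set a : ℝ := tStart j with ha
  set m : ℝ := tStart j + tHalf j with hm
  set b : ℝ := tStart (j + 1) with hb
  have hth : 0 < tHalf j := tHalf_pos j
  have ham : a ≤ m := by rw [ha, hm]; linarith
  have hmb : m ≤ b := by rw [hm, hb, tStart_succ]; linarith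
  have hH : Icc a m ⊆ S := fun t ht => hI ⟨ht.1, ht.2.trans hmb⟩
  have hV : Icc m b ⊆ S := fun t ht => hI ⟨ham.trans ht.1, ht.2⟩
  have haS : a ∈ S := hI ⟨le_rfl, ham.trans hmb⟩
  have hmS : m ∈ S := hI ⟨ham, hmb⟩
  have hbS : b ∈ S := hI ⟨ham.trans hmb, le_rfl⟩
  have hsm : ∀ t ∈ S, FunctionSpaces.Torus.IsSmooth (w t) := fun t ht => hw.smooth_scalar.isSmooth_slice ht
  have hδj : 0 < P.δ j := P.δ_pos hδ₀ (lt_of_lt_of_le one_pos hd) j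
  have hgrad : ∀ t ∈ S, ∀ x (i : Fin 2),
      FunctionSpaces.Torus.gradient (w t) x i = FunctionSpaces.Torus.partialDeriv i (w t) x := fun t ht x i =>
    Torus.gradient_apply_eq_partialDeriv ((hsm t ht).isContDiff (by simp)) x i
  -- names for the sups at the three times
  set A0 := ⨆ y, |FunctionSpaces.Torus.gradient (w a) y 0| with hA0
  set A1 := ⨆ y, |FunctionSpaces.Torus.gradient (w a) y 1| with hA1
  set M0 := ⨆ y, |FunctionSpaces.Torus.gradient (w m) y 0| with hM0
  set M1 := ⨆ y, |FunctionSpaces.Torus.gradient (w m) y 1| with hM1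
  have hA0le : ∀ x, |FunctionSpaces.Torus.partialDeriv 0 (w a) x| ≤ A0 := abs_partialDeriv_le_iSup (hsm a haS) 0
  have hA1le : ∀ x, |FunctionSpaces.Torus.partialDeriv 1 (w a) x| ≤ A1 := abs_partialDeriv_le_iSup (hsm a haS) 1
  have hM0le : ∀ x, |FunctionSpaces.Torus.partialDeriv 0 (w m) x| ≤ M0 := abs_partialDeriv_le_iSup (hsm m hmS) 0
  have hM1le : ∀ x, |FunctionSpaces.Torus.partialDeriv 1 (w m) x| ≤ M1 := abs_partialDeriv_le_iSup (hsm m hmS) 1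
  have hA0nn : 0 ≤ A0 := iSup_abs_gradient_nonneg (hsm a haS) 0
  have hM1nn : 0 ≤ M1 := iSup_abs_gradient_nonneg (hsm m hmS) 1
  -- structure of the field on the two half-slots
  have hH0 : ∀ t ∈ Icc a m, ∀ x, FunctionSpaces.Torus.partialDeriv 0 (P.field t) x = 0 := fun t ht x =>
    (P.partialDeriv_field_of_mem_H ht x).1
  have hV1 : ∀ t ∈ Icc m b, ∀ x, FunctionSpaces.Torus.partialDeriv 1 (P.field t) x = 0 := fun t ht x =>
    (P.partialDeriv_field_of_mem_V ht x).1
  have hHA : ∀ t ∈ Icc a m, ∀ x, |⟪FunctionSpaces.Torus.partialDeriv 1 (P.field t) x,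
      FunctionSpaces.Torus.gradient (w t) x⟫_ℝ| ≤ P.rateH j t * |FunctionSpaces.Torus.partialDeriv 0 (w t) x| := by
    intro t ht x
    have h := P.abs_inner_partialDeriv_field_le_of_mem_H hγ hδj ht x (FunctionSpaces.Torus.gradient (w t) x)
    rwa [hgrad t (hH ht) x 0] at h
  have hVA : ∀ t ∈ Icc m b, ∀ x, |⟪FunctionSpaces.Torus.partialDeriv 0 (P.field t) x,
      FunctionSpaces.Torus.gradient (w t) x⟫_ℝ| ≤ P.rateV j t * |FunctionSpaces.Torus.partialDeriv 1 (w t) x| := by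
    intro t ht x
    have h := P.abs_inner_partialDeriv_field_le_of_mem_V hγ hδj ht x (FunctionSpaces.Torus.gradient (w t) x)
    rwa [hgrad t (hV ht) x 1] at h
  have hmH : m ∈ Icc a m := ⟨ham, le_rfl⟩
  have hbV : b ∈ Icc m b := ⟨hmb, le_rfl⟩
  refine ⟨?_, ?_, ?_, ?_⟩
  · -- H half-slot: the `x₁`-gradient sup does not increase
    exact iSup_abs_gradient_le (hsm m hmS) 0 fun x =>
      hw.abs_partialDeriv_le_of_partialDeriv_velocity_eq_zero hκ hH 0 hA0le hH0 hmH x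
  · -- H half-slot: the `x₂`-gradient sup grows by at most `γ · sup|∂₁w(a)|`
    refine iSup_abs_gradient_le (hsm m hmS) 1 fun x => ?_
    have h := hw.abs_partialDeriv_le_add_mul_integral_of_shear hκ hH 0 1 hA0le hA1le hH0 hHA
      (fun t _ => P.rateH_nonneg hγ j t) (P.continuous_rateH j).continuousOn hmH x
    have hint : ∫ s in a..m, P.rateH j s ≤ P.γ := P.integral_rateH_le hγ hmH
    calc |FunctionSpaces.Torus.partialDeriv 1 (w m) x| ≤ A1 + A0 * ∫ s in a..m, P.rateH j s := h
      _ ≤ A1 + A0 * P.γ := by gcongr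
      _ = A1 + P.γ * A0 := by ring
  · -- V half-slot: the `x₂`-gradient sup does not increase
    exact iSup_abs_gradient_le (hsm b hbS) 1 fun x =>
      hw.abs_partialDeriv_le_of_partialDeriv_velocity_eq_zero hκ hV 1 hM1le hV1 hbV x
  · -- V half-slot: the `x₁`-gradient sup grows by at most `γ · sup|∂₂w(m)|`
    refine iSup_abs_gradient_le (hsm b hbS) 0 fun x => ?_
    have h := hw.abs_partialDeriv_le_add_mul_integral_of_shear hκ hV 1 0 hM1le hM0le hV1 hVA
      (fun t _ => P.rateV_nonneg hγ j t) (P.continuous_rateV j).continuousOn hbV x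
    have hint : ∫ s in m..b, P.rateV j s ≤ P.γ := P.integral_rateV_le hγ hbV
    calc |FunctionSpaces.Torus.partialDeriv 0 (w b) x| ≤ M0 + M1 * ∫ s in m..b, P.rateV j s := h
      _ ≤ M0 + M1 * P.γ := by gcongr
      _ = M0 + P.γ * M1 := by ring

end Summit.AnomalousDissipation.AnomalousDissipation.Theorems.SawtoothPulseCascade.K3NonlinearClosureLocalised

end
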